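import Mathlib.GroupTheory.Perm.ViaEmbedding
import Mathlib.GroupTheory.Perm.Fin
import Summits.MatrixMultiplication.OmegaCensus.BoxBadSmallGroups3
import Summits.MatrixMultiplication.OmegaCensus.BoxUsefulClasses
import Summits.MatrixMultiplication.OmegaCensus.BoxUsefulIndexSix

/-!
# ω-census, family (b3): conjecture C9 on the symmetric groups — `S_n = Equiv.Perm (Fin n)` is box-useful iff `n ≤ 3`

HONEST FRAMING (pub-omega census; verbatim): lottery ticket; floor = certified bounds/negative ranges.
Census BOOKKEEPING (conjecture C9 of the cell; pub-omega stpp-1 gen 18): the hand-built kernel model `A4h` of `A₄`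
(`BoxBadSmallGroups3`, `27`-cell witness, not box-useful) EMBEDS into `Equiv.Perm (Fin 4)` — `(v, t) ↦ σ_v · c^t` with
`σ_(1,0) = (0 1)(2 3)`, `σ_(0,1) = (0 2)(1 3)`, `c = (1 2 3)` (`A4h.toPermHom`, multiplicativity and injectivity by `decide`
over the `144` pairs) — and `Perm (Fin 4)` embeds into `Perm (Fin n)` for `n ≥ 4` (`Equiv.Perm.viaEmbeddingHom` of
`Fin.castLEEmb`).  So by `not_boxUseful_of_injective_a4h`: **`S_n` is NOT box-useful for every `n ≥ 4`**
(`not_boxUseful_perm_fin`), while `S_0, S_1, S_2` (abelian) and `S_3 ≅ D_6` (centre of index `6`) ARE: the CLASSIFICATION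
`boxUseful_perm_fin_iff : BoxUseful (Equiv.Perm (Fin n)) ↔ n ≤ 3` — conjecture C9 (b) holds on the whole symmetric family.
Nothing here is progress on `ω`.
-/

namespace Summit.MatrixMultiplication.OmegaCensus

open Finset ProductBoxBound Equiv

namespace A4h

/-- The Klein four-group part: `σ_(0,0) = 1`, `σ_(1,0) = (0 1)(2 3)`, `σ_(0,1) = (0 2)(1 3)`, `σ_(1,1) = (0 3)(1 2)`. [folklore] -/
def sigmaV (p q : ZMod 2) : Perm (Fin 4) :=
  if p = 0 then (if q = 0 then 1 else swap 0 2 * swap 1 3) else (if q = 0 then swap 0 1 * swap 2 3 else swap 0 3 * swap 1 2)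

/-- The `3`-cycle `c = (1 2 3)`. [folklore] -/
def cyc3 : Perm (Fin 4) := swap 1 2 * swap 2 3

/-- The embedding `A4h → S₄`, `(v, t) ↦ σ_v c^t`. [folklore] -/
def toPerm (x : A4h) : Perm (Fin 4) := sigmaV x.p x.q * cyc3 ^ x.t.val

/-- `toPerm` is multiplicative (checked on all `144` pairs). [folklore] -/
theorem toPerm_mul : ∀ x y : A4h, toPerm (x * y) = toPerm x * toPerm y := by decide

/-- `toPerm` is injective (checked on all `144` pairs). [folklore] -/
theorem toPerm_injective : Function.Injective toPerm := by
  intro x y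
  revert x y
  decide

/-- **`A₄` (as `A4h`) embeds into `S₄`.** [folklore] -/
def toPermHom : A4h →* Perm (Fin 4) := MonoidHom.mk' toPerm toPerm_mul

end A4h

/-- **`S₄` is not box-useful** (it contains `A₄`). [folklore] -/
theorem not_boxUseful_perm_fin_four : ¬ BoxUseful (Perm (Fin 4)) :=
  not_boxUseful_of_injective_a4h A4h.toPermHom A4h.toPerm_injective

/-- **`S_n = Equiv.Perm (Fin n)` is not box-useful for every `n ≥ 4`** (`A₄ ↪ S₄ ↪ S_n`). [folklore] -/
theorem not_boxUseful_perm_fin {n : ℕ} (h : 4 ≤ n) : ¬ BoxUseful (Perm (Fin n)) :=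
  not_boxUseful_of_injective_a4h ((Perm.viaEmbeddingHom (Fin.castLEEmb h)).comp A4h.toPermHom)
    ((Perm.viaEmbeddingHom_injective _).comp A4h.toPerm_injective)

/-- A commutative-by-`decide` group has centre of index `1`. [folklore] -/
theorem center_index_eq_one_of_comm {G : Type*} [Group G] (h : ∀ a b : G, a * b = b * a) :
    (Subgroup.center G).index = 1 := by
  rw [Subgroup.index_eq_one, Subgroup.eq_top_iff']
  intro x; rw [Subgroup.mem_center_iff]; intro g; exact h g x

/-- `S_0` is box-useful (trivial group). [folklore] -/
theorem boxUseful_perm_fin_zero : BoxUseful (Perm (Fin 0)) :=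
  BoxUseful.of_index_center_one (center_index_eq_one_of_comm (by decide))

/-- `S_1` is box-useful (trivial group). [folklore] -/
theorem boxUseful_perm_fin_one : BoxUseful (Perm (Fin 1)) :=
  BoxUseful.of_index_center_one (center_index_eq_one_of_comm (by decide))

/-- `S_2 ≅ C₂` is box-useful. [folklore] -/
theorem boxUseful_perm_fin_two : BoxUseful (Perm (Fin 2)) :=
  BoxUseful.of_index_center_one (center_index_eq_one_of_comm (by decide))

/-- `S_3 ≅ D_6` is box-useful (trivial centre, index `6`). [folklore] -/
theorem boxUseful_perm_fin_three : BoxUseful (Perm (Fin 3)) := by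
  apply BoxUseful.of_index_center_six
  have hc : Nat.card (Subgroup.center (Perm (Fin 3))) = 1 := by
    rw [Nat.card_eq_fintype_card]; decide
  have hG : Nat.card (Perm (Fin 3)) = 6 := by
    rw [Nat.card_eq_fintype_card, Fintype.card_perm, Fintype.card_fin]; rfl
  have := (Subgroup.center (Perm (Fin 3))).card_mul_index
  rw [hc, hG] at this
  omega

/-- **CLASSIFICATION of the symmetric groups under C9: `Equiv.Perm (Fin n)` is box-useful iff `n ≤ 3`** (the abelian
`S_0, S_1, S_2` and the centre-index-`6` group `S_3`), as conjecture C9 (b) predicts. [folklore] -/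
theorem boxUseful_perm_fin_iff {n : ℕ} : BoxUseful (Perm (Fin n)) ↔ n ≤ 3 := by
  constructor
  · intro h
    by_contra hn
    exact not_boxUseful_perm_fin (by omega) h
  · intro hn
    interval_cases n
    · exact boxUseful_perm_fin_zero
    · exact boxUseful_perm_fin_one
    · exact boxUseful_perm_fin_two
    · exact boxUseful_perm_fin_three

end Summit.MatrixMultiplication.OmegaCensus
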